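import Literature.NumberTheory.Transcendental.GFunctionHassePrinciple
import HarnessLib

/-!
# `G`-functions over a number field embed to `G`-series (PROVED bridge between the two layers)

`Literature/NumberTheory/Transcendental/GFunctionEmbedding.lean` — for a number field `K`, a
complex embedding `σ : K →+* ℂ` and a `G`-function `y = ∑ aₙ Xⁿ ∈ K⟦X⟧`
(`Literature.NumberTheory.Transcendental.IsGFunction`), the embedded coefficient sequence
`n ↦ σ(aₙ)` is a `G`-series in the sense of Siegel/Rivoal
(`Literature.NumberTheory.Transcendental.IsGSeries`): Rivoal's remark (p. 243) that in
Définition 5.22 (ii) it suffices to let `σ` range over the embeddings of the number field `K`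
generated by the coefficients, made formal via
`NumberField.Embeddings.range_eval_eq_rootSet_minpoly` (the complex roots of `minpoly ℚ a` are
exactly the `τ(a)`, `τ : K →+* ℂ`). [Rivoal2024, Déf. 5.22 and p. 243]
-/

noncomputable section

namespace Literature.NumberTheory.Transcendental

open Polynomial PowerSeries

variable {K : Type*} [Field K]

/-- The formal derivative commutes with mapping the coefficients along a ring hom. [folklore] -/
theorem map_derivative_eq {S : Type*} [CommRing S] (f : K →+* S) (y : PowerSeries K) :
    PowerSeries.map f (PowerSeries.derivative K y) = PowerSeries.derivative S (PowerSeries.map f y) := by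
  ext n
  simp [PowerSeries.coeff_derivative, PowerSeries.coeff_map]

/-- Iterated formal derivatives commute with mapping the coefficients. [folklore] -/
theorem map_iterate_derivative_eq {S : Type*} [CommRing S] (f : K →+* S) (y : PowerSeries K) (j : ℕ) :
    PowerSeries.map f ((⇑(PowerSeries.derivative K))^[j] y) =
      (⇑(PowerSeries.derivative S))^[j] (PowerSeries.map f y) := by
  induction j generalizing y with
  | zero => simp
  | succ j ih =>
    rw [Function.iterate_succ_apply, Function.iterate_succ_apply, ← map_derivative_eq, ih]

/-- Mapping the coefficients of `y` along `f` gives the series with coefficients `f(aₙ)`.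
[folklore] -/
theorem map_eq_mk_coeff {S : Type*} [CommRing S] (f : K →+* S) (y : PowerSeries K) :
    PowerSeries.map f y = PowerSeries.mk fun n => f (coeff n y) := by
  ext n
  simp [PowerSeries.coeff_map]

variable [NumberField K]

/-- **A `G`-function over a number field `K` embeds to a `G`-series**: for `σ : K →+* ℂ` and a
`G`-function `y = ∑ aₙ Xⁿ ∈ K⟦X⟧`, the sequence `σ(aₙ)` is a `G`-series (Rivoal Déf. 5.22):
the `σ(aₙ)` are algebraic; the ODE over `K[X]` maps to one over `ℚ̄[X] ⊆ ℂ[X]`; the conjugates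
of `σ(aₙ)` are the `τ(aₙ)`, `τ : K →+* ℂ`, all bounded by `C^{n+1}`; and `dₙ σ(a_m) = σ(dₙ a_m)`
is an algebraic integer. PROVED. [cite: Rivoal2024, Définition 5.22 and p. 243] -/
theorem IsGFunction.isGSeries_embedding {y : PowerSeries K} (hy : IsGFunction y) (σ : K →+* ℂ) :
    IsGSeries fun n => σ (coeff n y) := by
  obtain ⟨⟨m, P, hP0, hode⟩, ⟨C, hC, hgrowth⟩, ⟨d, D, hD, hden⟩⟩ := hy
  have halg : ∀ x : K, IsAlgebraic ℚ (σ x) := fun x =>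
    (Algebra.IsAlgebraic.isAlgebraic (R := ℚ) x).algHom σ.toRatAlgHom
  refine ⟨fun n => halg _, ?_, ?_, ?_⟩
  · -- (i) the ODE, mapped along `σ`
    refine ⟨m, fun j => (P j).map σ, ?_, fun j k => ?_, ?_⟩
    · intro h
      apply hP0
      funext j
      have := congr_fun h j
      simpa [Polynomial.map_eq_zero_iff σ.injective] using this
    · rw [Polynomial.coeff_map]
      exact halg _
    · have := congrArg (PowerSeries.map σ) hode
      rw [map_sum, map_zero] at this
      rw [← map_eq_mk_coeff]
      convert this using 2 with j
      rw [map_mul, Polynomial.polynomial_map_coe, map_iterate_derivative_eq]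
  · -- (ii) conjugates = images under the embeddings
    refine ⟨C, hC, fun n b hb => ?_⟩
    have hmin : minpoly ℚ (σ (coeff n y)) = minpoly ℚ (coeff n y) :=
      minpoly.algHom_eq σ.toRatAlgHom σ.injective (coeff n y)
    rw [hmin, ← NumberField.Embeddings.range_eval_eq_rootSet_minpoly K ℂ (coeff n y)] at hb
    obtain ⟨τ, rfl⟩ := hb
    exact hgrowth τ n
  · -- (iii) denominators
    refine ⟨fun n => (d n : ℤ), D, hD, fun n => ⟨?_, ?_, fun k hk => ?_⟩⟩
    · have := (hden n).1
      simp only [Nat.one_le_cast]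
      exact this
    · have := (hden n).2.1
      simpa using this
    · have hint := ((hden n).2.2 k hk).map σ.toIntAlgHom
      simpa using hint

end Literature.NumberTheory.Transcendental
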